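import Summits.ResolutionOfSingularities.ResolutionOfSingularities.Theorems.PurelyInseparableDim4ExceptionalLengthBound
import Summits.ResolutionOfSingularities.ResolutionOfSingularities.Theorems.PurelyInseparableDim4NarrowTail
import HarnessLib
import HarnessLib.Audit.Tags

/-!
# Purely inseparable dim 4 — (Λ3) the FREE-RUN BOUND: at most `Λ − 1 ≤ μ⁺ − 2` consecutive E-free moves

Sequel of `…ExceptionalLength` ((U)/(NT), p662098), `…ExceptionalLengthFree` ((Λ1), p662834) and
`…ExceptionalLengthBound` ((Λ2), p663754).  CARD I-3-12 of cell `res-dim4-pi` (seat idea-3), law **(Λ3)**, along a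
WITNESSED chain (`FreeTail.IsWitnessedChain p c j b`: `c (k+1) = CentreBlowup.step p univ (j k) (b k) (c k)` at an
equimultiple point, every state of order `≥ p`).  Move `m+1` is E-FREE with respect to the exceptional hyperplane
`{x_{j m} = 0}` created by move `m` iff `¬ FreeTail.IsSatellite j b m` (`j (m+1) = j m ∨ b (m+1) (j m) ≠ 0`).

* `free_run_transport` — if `x_{j k₀}^ℓ ∈ Ĵ⁺(c (k₀+1))` and the moves `k₀+1, …, k₀+n` are E-free (`n ≤ ℓ`), then
  `x_{j (k₀+n)}^{ℓ−n} ∈ Ĵ⁺(c (k₀+n+1))` ((Λ1) iterated; «`∈ Ĵ⁺`» = «`∈ J_p⁺ + 𝔪₀^M` for every `M`»).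
* **`exists_isSatellite_of_X_pow_mem`** — hence the `ℓ` moves `k₀+1, …, k₀+ℓ` are NOT all E-free: some
  `m ∈ [k₀, k₀+ℓ)` is a satellite index (else `1 ∈ J_p⁺ + 𝔪₀ = 𝔪₀`).
* **`exists_isSatellite_lt_jetColength`** — with (Λ2): if `c k₀` carries a colength certificate (`IsCert p N`,
  `μ⁺ = jetColength p N (c k₀).F`), some move among `k₀+1, …, k₀+μ⁺−1` is a satellite move: **at most `μ⁺(c k₀) − 2`
  consecutive E-free moves follow move `k₀`** — the quantitative form of the tree's free-tail theorem FT(p,p).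
* Remark (§3): with `IsolationConverse.exists_certificate_of_isIsolated` this is a second route to the tree's
  `FreeTailProof.noIsolatedFreeTailAt_self` (FT(p,p), p659995, by polynomial arcs) — cited, not restated.

[cite: Kollar2007, (3.75.1)–(3.75.3) and Theorem 3.76 (derivative ideals under blow-up; char p, m = p)]
OURS · counted 0 · nothing here proves `NoWideTrap`, `NoIsolatedTrap 3 3`, or resolution of singularities in
dimension `≥ 4` / characteristic `p`.  Supports stmt-ResolutionOfSingularities-16155 (helper).
bears_on: LADDER-RESOLUTION:D157-DOOR2 (res-dim4-pi · E2(3,3) wide core · I-3-12 (Λ3)).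
-/

set_option linter.dupNamespace false -- mandated namespace of this single-conjunct summit

noncomputable section

namespace Summit.ResolutionOfSingularities.ResolutionOfSingularities.Theorems.PIDim4

namespace ExceptionalLength

open MvPolynomial Finset
open Literature.AlgebraicGeometry
open Literature.AlgebraicGeometry.Resolution

variable {K : Type} [Field K]

/-- E-free (= not satellite) in the form law (Λ1) consumes. [folklore] -/
theorem free_of_not_isSatellite {j : ℕ → Fin 4} {b : ℕ → Fin 4 → K} {m : ℕ}
    (h : ¬ FreeTail.IsSatellite j b m) : j (m + 1) = j m ∨ b (m + 1) (j m) ≠ 0 := by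
  by_cases hj : j (m + 1) = j m
  · exact Or.inl hj
  · exact Or.inr fun hb => h ⟨hj, hb⟩

/-! ## 1. Transport along an E-free run -/

/-- **(Λ1) iterated along an E-free run.**  Along a witnessed chain, if `x_{j k₀}^ℓ ∈ J_p⁺(c (k₀+1)) + 𝔪₀^M` for
all `M` and the moves `k₀+1, …, k₀+n` are E-free (`¬ IsSatellite j b m` for `k₀ ≤ m < k₀+n`), `n ≤ ℓ`, then
`x_{j (k₀+n)}^{ℓ−n} ∈ J_p⁺(c (k₀+n+1)) + 𝔪₀^M` for all `M`. [cite: Kollar2007, Theorem 3.76 (char p, m = p)] -/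
theorem free_run_transport (p : ℕ) [Fact p.Prime] [CharP K p] [DecidableEq K] {c : ℕ → State K}
    {j : ℕ → Fin 4} {b : ℕ → Fin 4 → K} (hw : FreeTail.IsWitnessedChain p c j b) (k₀ : ℕ) {ℓ : ℕ}
    (hx : ∀ M : ℕ, (X (j k₀) : MvPolynomial (Fin 4) K) ^ ℓ ∈
      singLocusIdeal p (c (k₀ + 1)).F ⊔ originIdeal K ^ M) :
    ∀ n, n ≤ ℓ → (∀ m, k₀ ≤ m → m < k₀ + n → ¬ FreeTail.IsSatellite j b m) →
      ∀ M : ℕ, (X (j (k₀ + n)) : MvPolynomial (Fin 4) K) ^ (ℓ - n) ∈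
        singLocusIdeal p (c (k₀ + n + 1)).F ⊔ originIdeal K ^ M := by
  intro n
  induction n with
  | zero =>
    intro _ _ M
    simpa using hx M
  | succ n ih =>
    intro hn hfree M
    have ih' := ih (by omega) (fun m h1 h2 => hfree m h1 (by omega))
    have hns : ¬ FreeTail.IsSatellite j b (k₀ + n) := hfree (k₀ + n) (by omega) (by omega)
    obtain ⟨hord, hbj, -, -, hc⟩ := hw (k₀ + n + 1)
    have h := forall_X_pow_pred_mem_of_free p (c (k₀ + n + 1)) (j (k₀ + n + 1)) (j (k₀ + n))
      (b (k₀ + n + 1)) hbj (free_of_not_isSatellite hns) hord (ℓ := ℓ - n) (by omega) ih' M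
    rw [← hc] at h
    have e : ℓ - (n + 1) = ℓ - n - 1 := by omega
    rw [e]
    exact h

/-! ## 2. (Λ3): the run ends — a satellite move within `ℓ` moves -/

/-- **(Λ3) A satellite move within `Λ` moves.**  Along a witnessed chain, if `x_{j k₀}^ℓ ∈ J_p⁺(c (k₀+1)) + 𝔪₀^M`
for all `M` (e.g. `ℓ = Λ(c (k₀+1))`, the length of the newest exceptional coordinate), then some move among
`k₀+1, …, k₀+ℓ` is a SATELLITE move: `∃ m ∈ [k₀, k₀+ℓ)`, `IsSatellite j b m` (otherwise `x^0 = 1 ∈ J_p⁺ + 𝔪₀ = 𝔪₀`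
at `c (k₀+ℓ+1)`).  So an E-free run after move `k₀` has length `≤ ℓ − 1`.
[cite: Kollar2007, Theorem 3.76 (char p, m = p)] -/
theorem exists_isSatellite_of_X_pow_mem (p : ℕ) [Fact p.Prime] [CharP K p] [DecidableEq K]
    {c : ℕ → State K} {j : ℕ → Fin 4} {b : ℕ → Fin 4 → K} (hw : FreeTail.IsWitnessedChain p c j b)
    (k₀ : ℕ) {ℓ : ℕ}
    (hx : ∀ M : ℕ, (X (j k₀) : MvPolynomial (Fin 4) K) ^ ℓ ∈
      singLocusIdeal p (c (k₀ + 1)).F ⊔ originIdeal K ^ M) :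
    ∃ m, k₀ ≤ m ∧ m < k₀ + ℓ ∧ FreeTail.IsSatellite j b m := by
  by_contra hno
  push Not at hno
  have h := free_run_transport p hw k₀ hx ℓ le_rfl (fun m h1 h2 => hno m h1 h2) 1
  rw [Nat.sub_self, pow_zero, pow_one] at h
  have hJ : singLocusIdeal p (c (k₀ + ℓ + 1)).F ≤ originIdeal K :=
    IsolatedScope.singLocusIdeal_le_originIdeal_of_le_ordAlong_univ (hw (k₀ + ℓ + 1)).1
  have h1 : (1 : MvPolynomial (Fin 4) K) ∈ originIdeal K := (sup_le hJ le_rfl) h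
  exact IsolationCert.originIdeal_ne_top K ((Ideal.eq_top_iff_one _).mpr h1)

/-- **(Λ2)+(Λ3): at most `μ⁺ − 2` consecutive E-free moves.**  Along a witnessed chain, if `c k₀` carries a
colength certificate at level `N` with `μ⁺ := jetColength p N (c k₀).F`, then some move among `k₀+1, …, k₀+μ⁺−1`
is a satellite move: `∃ m`, `k₀ ≤ m < k₀ + (μ⁺ − 1)`, `IsSatellite j b m` ((Λ2): `x_{j k₀}^{μ⁺−1} ∈ Ĵ⁺(c (k₀+1))`,
then (Λ3)). [cite: Kollar2007, Theorem 3.76 (char p, m = p)] -/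
theorem exists_isSatellite_lt_jetColength (p : ℕ) [Fact p.Prime] [CharP K p] [DecidableEq K]
    {c : ℕ → State K} {j : ℕ → Fin 4} {b : ℕ → Fin 4 → K} (hw : FreeTail.IsWitnessedChain p c j b)
    (k₀ : ℕ) {N : ℕ} (hc : RidgeBudget.IsCert p N (c k₀).F) :
    ∃ m, k₀ ≤ m ∧ m < k₀ + (RidgeBudget.jetColength p N (c k₀).F - 1) ∧ FreeTail.IsSatellite j b m := by
  obtain ⟨hord, hbj, -, -, hck⟩ := hw k₀
  have hJ : singLocusIdeal p (c k₀).F ≤ originIdeal K :=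
    IsolatedScope.singLocusIdeal_le_originIdeal_of_le_ordAlong_univ hord
  have hμ : 1 ≤ RidgeBudget.jetColength p N (c k₀).F := RidgeBudget.one_le_jetColength hJ hc
  have hx : ∀ M : ℕ, (X (j k₀) : MvPolynomial (Fin 4) K) ^ (RidgeBudget.jetColength p N (c k₀).F - 1) ∈
      singLocusIdeal p (c (k₀ + 1)).F ⊔ originIdeal K ^ M := by
    intro M
    rw [hck]
    exact forall_X_pow_jetColength_pred_mem p (c k₀) (j k₀) (b k₀) hbj hord hc hμ M
  exact exists_isSatellite_of_X_pow_mem p hw k₀ hx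

/-- The run-length form: if the moves `k₀+1, …, k₀+n` are all E-free then `n + 2 ≤ μ⁺(c k₀)`.
[cite: Kollar2007, Theorem 3.76 (char p, m = p)] -/
theorem free_run_length_add_two_le_jetColength (p : ℕ) [Fact p.Prime] [CharP K p] [DecidableEq K]
    {c : ℕ → State K} {j : ℕ → Fin 4} {b : ℕ → Fin 4 → K} (hw : FreeTail.IsWitnessedChain p c j b)
    (k₀ : ℕ) {N : ℕ} (hc : RidgeBudget.IsCert p N (c k₀).F) {n : ℕ}
    (hfree : ∀ m, k₀ ≤ m → m < k₀ + n → ¬ FreeTail.IsSatellite j b m) :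
    n + 2 ≤ RidgeBudget.jetColength p N (c k₀).F := by
  obtain ⟨m, hm1, hm2, hsat⟩ := exists_isSatellite_lt_jetColength p hw k₀ hc
  by_contra hlt
  exact hfree m hm1 (by omega) hsat

/-! ## 3. Remark: a second route to FT(p,p)

`exists_isSatellite_lt_jetColength` together with `IsolationConverse.exists_certificate_of_isIsolated` re-proves the
tree's free-tail theorem `FreeTailProof.noIsolatedFreeTailAt_self : FreeTail.NoIsolatedFreeTailAt p p` (p659995, by
polynomial arcs) through exceptional lengths: an isolation certificate at `c k₀` forces a satellite move among the
next `μ⁺ − 1` moves.  (Not restated as a declaration: the landed statement is cited, gate dedup.) -/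

end ExceptionalLength

end Summit.ResolutionOfSingularities.ResolutionOfSingularities.Theorems.PIDim4

end
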